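import Summits.NavierStokesRegularity.FluidComputer.PalasekTowerStrainDoorAtSharp
import Summits.NavierStokesRegularity.FluidComputer.PalasekTowerStrainHybridShadowedRunExists
import Summits.NavierStokesRegularity.FluidComputer.PalasekTowerGermHostMechanismDoorAt

/-!
# THE STRAIN DOOR AT ARBITRARY RATES `R`, VI: the HYBRID-currency certificate letter (route (A′)) and its compositions
# into `EpisodeBaseGAt R` and, at `tuned` (door paid by `Germ.mechanismDoorAt_of_boxNumerics`), into `EpisodeBaseGAt tuned`

Cell `ns-blowup`, seat `ns-blowup-fc-prover-2` (g10), by copy of the LEAD's `PalasekTowerStrainDoorAtH2.lean` (p536855, route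
(B)) as the LEAD asked (STATUS 2026-08-27T15:54Z «SUCCESSOR LEAD: type `StrainDoor.CertificateDataHybrid R …` + the composition by
copy of my p536855»). LABEL: E–C typing (one open `Prop`-valued structure parametrised by the rates record and two sorry-free
compositions). WHAT THIS IS NOT: not Navier–Stokes evidence — nothing is inhabited; no run, design or certificate is exhibited;
the letter is OPEN at `R = tuned`.

* `CertificateDataHybrid R …` — EXACTLY the hypothesis data of the hybrid existence door
  `StrainShadowHybrid.exists_freeRun_near_of_strainHybrid` (datum statics; reference run `(w, ϖ)` forced by its defect `r`
  on `[0, wfirstAt R]`, Tao class, speed `≤ B_w`; majorants `G ≥ 0`, `σ₂`, `σ₃`, `R_r`, `L`, `H₁`, `ψ₁`, `ψ₂`, `X₁`; the `H¹`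
  inputs `D₁, Ψ₁`, half-smallness and `X₁`-domination on the window; the smoothing window `0 < τw ≤ wfirstAt R`; EARLY `H²`
  inputs `D₂` (datum `H²` defect), `Ψ₂ ≥ ∫₀^{τw}ψ₂`, half-smallness and readout on `[0, τw]`; LATE inputs `Dτ, Ψτ` with the
  dissipation budget, source, half-smallness and readout on every sliding window `[t − τw, t]`, `t ∈ [τw, wfirstAt R]`), plus the
  four explicit readouts of the slice `w(wfirstAt R)` with margins `η + δ` — verbatim as in `CertificateDataH2`. Compared with
  route (B) the `H²` letter never runs over the long window: its fee `e^{Λ₂}` is paid over ONE window `τw`.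
* `episodeBaseGAt_of_mechanismDoorAt_of_certificateDataHybrid` — `MechanismDoorAt R → CertificateDataHybrid R … → EpisodeBaseGAt R`.
* `episodeBaseGAt_tuned_of_certificateDataHybrid` — at `R = tuned` the door is the tree's
  `Germ.mechanismDoorAt_of_boxNumerics TowerRates.tuned_boxNumerics` (p537983): ONE hybrid certificate ⇒ `EpisodeBaseGAt tuned`
  (= the crux `EpisodeBaseT` by `rfl`, stated in the Theorems file that closes it, not here).
The `agmonConst` fields are non-numeric today; the numeral twin follows the `AgmonBoundR3` re-thread of the vein (p541875).

References: [cite: RobinsonRodrigoSadowskiCUP2016, Thm 9.1 and Thm 1.20]; [cite: DashtiRobinson2008, Thm 1, Thm 2];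
[cite: ConstantinFoias1988, Ch. 10]; [cite: Tao2011, Thm. 5.4 (ii)+(iv)]; [cite: Palasek2026ElementaryModel, §4].
-/

noncomputable section

namespace Summit.NavierStokesRegularity.FluidComputer.PalasekTowerClayBridge.StrainDoor

open Set MeasureTheory Metric Function InnerProductSpace
open scoped ENNReal NNReal ContDiff RealInnerProductSpace
open Literature.Analysis Literature.Analysis.FluidPDE

/-- **The data of ONE STRAIN CERTIFICATE IN HYBRID CURRENCY at the rates `R`** (route (A′): `H¹` on the window, `H²` by
smoothing on sliding windows of length `τw`; see the module docstring for the reading of each group of fields).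
[cite: RobinsonRodrigoSadowskiCUP2016, Thm 9.1 and Thm 1.20] [cite: DashtiRobinson2008, Thm 1, Thm 2] [cite: ConstantinFoias1988, Ch. 10] -/
structure CertificateDataHybrid (R : TowerRates)
    (U : EuclideanSpace ℝ (Fin 3) → EuclideanSpace ℝ (Fin 3)) (ρ : ℝ)
    (w r : ℝ → EuclideanSpace ℝ (Fin 3) → EuclideanSpace ℝ (Fin 3)) (ϖ : ℝ → EuclideanSpace ℝ (Fin 3) → ℝ)
    (G σ₂ σ₃ Rr L H₁ ψ₁ ψ₂ X₁ Dτ Ψτ : ℝ → ℝ) (Bw E₀ κ μ D₁ Ψ₁ D₂ Ψ₂ δ η τw : ℝ) : Prop where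
  /-- the smoothing window length -/
  τw_pos : 0 < τw
  τw_le : τw ≤ Host.wfirstAt R
  /-- datum statics -/
  datum_smooth : ContDiff ℝ ∞ U
  datum_divFree : VectorCalculus.IsDivFree U
  datum_support : tsupport U ⊆ closedBall 0 ρ
  datum_lt : ∀ x, ‖U x‖ < R.Y 0
  radius_nonneg : 0 ≤ ρ
  /-- the reference run forced by its defect `r`, Tao's class, `r(t), Dr(t) ∈ L²`, speed bound -/
  run : IsClassicalNSSolutionOn (Icc 0 (Host.wfirstAt R)) 1 r w ϖ
  sobolev : HasBoundedSobolevNormsOn (Icc 0 (Host.wfirstAt R)) w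
  sobolev_t : HasBoundedSobolevNormsOn (Icc 0 (Host.wfirstAt R)) (FluidPDE.timeDerivWithin (Icc 0 (Host.wfirstAt R)) w)
  pressure : ∀ n : ℕ, ∃ C' : ℝ≥0, ∀ t ∈ Icc 0 (Host.wfirstAt R), ∫⁻ x, ‖iteratedFDeriv ℝ n (ϖ t) x‖ₑ ^ 2 ≤ C'
  residual_L2 : ∀ t ∈ Icc 0 (Host.wfirstAt R), ∫⁻ x, ‖r t x‖ₑ ^ 2 < ⊤
  residual_D : ∀ t ∈ Icc 0 (Host.wfirstAt R), ∫⁻ x, ‖fderiv ℝ (r t) x‖ₑ ^ 2 < ⊤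
  speed_bdd : ∀ t ∈ Icc 0 (Host.wfirstAt R), ∀ y, ‖w t y‖ ≤ Bw
  /-- majorants: compression rate `G ≥ 0`, Hessian `σ₂`, third derivative `σ₃`, residual size `R_r`, `L²` envelope `L`,
  residual gradient `H₁`, the two source terms `ψ₁, ψ₂`, the `H¹` envelope `X₁`; `κ, μ > 0` -/
  κ_pos : 0 < κ
  μ_pos : 0 < μ
  strain : ∀ s ∈ Icc 0 (Host.wfirstAt R), ∀ (x ξ : EuclideanSpace ℝ (Fin 3)), -⟪fderiv ℝ (w s) x ξ, ξ⟫ ≤ G s * ‖ξ‖ ^ 2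
  G_nonneg : ∀ s ∈ Icc 0 (Host.wfirstAt R), 0 ≤ G s
  hess : ∀ s ∈ Icc 0 (Host.wfirstAt R), ∀ x, ‖iteratedFDeriv ℝ 2 (w s) x‖ ≤ σ₂ s
  third : ∀ s ∈ Icc 0 (Host.wfirstAt R), ∀ x, ‖iteratedFDeriv ℝ 3 (w s) x‖ ≤ σ₃ s
  Rr_nonneg : ∀ s ∈ Icc 0 (Host.wfirstAt R), 0 ≤ Rr s
  residual_two : ∀ s ∈ Icc 0 (Host.wfirstAt R), ∫ x, ‖r s x‖ ^ 2 ≤ Rr s ^ 2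
  L_def : ∀ s ∈ Icc 0 (Host.wfirstAt R), (E₀ + ∫ τ in (0 : ℝ)..s, Rr τ) * Real.exp (∫ τ in (0 : ℝ)..s, G τ) ≤ L s
  H₁_def : ∀ s ∈ Icc 0 (Host.wfirstAt R), ∫ x, ‖fderiv ℝ (fun y => r s y - (0 : EuclideanSpace ℝ (Fin 3))) x‖ ^ 2 ≤ H₁ s
  ψ₁_def : ∀ s ∈ Icc 0 (Host.wfirstAt R), 2 / 1 * (∫ x, ‖r s x - (0 : EuclideanSpace ℝ (Fin 3))‖ ^ 2) +
    3 * σ₂ s / κ * L s ^ 2 ≤ ψ₁ s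
  ψ₂_def : ∀ s ∈ Icc 0 (Host.wfirstAt R), 27 * σ₂ s / κ * X₁ s + 9 * σ₃ s / κ ^ 2 * L s ^ 2 + 6 / 1 * H₁ s ≤ ψ₂ s
  G_cont : ContinuousOn G (Icc 0 (Host.wfirstAt R))
  σ₂_cont : ContinuousOn σ₂ (Icc 0 (Host.wfirstAt R))
  σ₃_cont : ContinuousOn σ₃ (Icc 0 (Host.wfirstAt R))
  Rr_cont : ContinuousOn Rr (Icc 0 (Host.wfirstAt R))
  L_cont : ContinuousOn L (Icc 0 (Host.wfirstAt R))
  X₁_cont : ContinuousOn X₁ (Icc 0 (Host.wfirstAt R))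
  H₁_cont : ContinuousOn H₁ (Icc 0 (Host.wfirstAt R))
  ψ₁_cont : ContinuousOn ψ₁ (Icc 0 (Host.wfirstAt R))
  ψ₂_cont : ContinuousOn ψ₂ (Icc 0 (Host.wfirstAt R))
  /-- datum defects at `L²`, `H¹`, `H²` level and the window integrals of the source terms -/
  E₀_nonneg : 0 ≤ E₀
  datum_two : ∫ x, ‖U x - w 0 x‖ ^ 2 ≤ E₀ ^ 2
  datum_H1 : ∫ x, frobeniusNormSq (fderiv ℝ (fun y => U y - w 0 y) x) ≤ D₁
  datum_H2 : (∑ i, ∫ x, frobeniusNormSq (fderiv ℝ (fun y => fderiv ℝ (fun z => U z - w 0 z) y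
    (EuclideanSpace.basisFun (Fin 3) ℝ i)) x)) ≤ D₂
  Ψ₁_def : ∫ s in (0 : ℝ)..Host.wfirstAt R, ψ₁ s ≤ Ψ₁
  Ψ₂_def : ∫ s in (0 : ℝ)..τw, ψ₂ s ≤ Ψ₂
  /-- the `H¹` HALF-smallness on the window, the `X₁` domination, and the EARLY `H²` inputs on `[0, τw]` (half-smallness,
  readout domination; contain `agmonConst`, non-numeric today) -/
  half₁ : 2 * (agmonConst ^ 4 / (2 * (1 : ℝ) ^ 3) *
      Real.exp (2 * ∫ s in (0 : ℝ)..Host.wfirstAt R, (4 * G s + 3 * κ * σ₂ s))) * (D₁ + Ψ₁) ^ 2 *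
      (Host.wfirstAt R - 0) ≤ 1 / 2
  X₁_dom : ∀ s ∈ Icc 0 (Host.wfirstAt R),
    Real.sqrt 2 * (Real.exp (∫ τ in (0 : ℝ)..s, (4 * G τ + 3 * κ * σ₂ τ)) * (D₁ + Ψ₁)) ≤ X₁ s
  half₂ : agmonConst ^ 2 * μ / 1 *
      Real.exp (∫ s in (0 : ℝ)..τw, (6 * G s + 9 * κ * σ₂ s + 3 * κ ^ 2 * σ₃ s +
        3 * agmonConst ^ 2 * X₁ s / (1 * μ) + 27 * agmonConst ^ 4 * X₁ s ^ 2 / (16 * (1 : ℝ) ^ 3))) *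
      (D₂ + Ψ₂) * (τw - 0) ≤ 1 / 2
  readout_early : ∀ t ∈ Icc 0 τw, agmonConst * (3 * X₁ t *
    (2 * (Real.exp (∫ s in (0 : ℝ)..t, (6 * G s + 9 * κ * σ₂ s + 3 * κ ^ 2 * σ₃ s +
        3 * agmonConst ^ 2 * X₁ s / (1 * μ) + 27 * agmonConst ^ 4 * X₁ s ^ 2 / (16 * (1 : ℝ) ^ 3))) *
      (D₂ + Ψ₂)))) ^ (1 / 4 : ℝ) ≤ δ
  /-- the LATE inputs on the sliding windows `[t − τw, t]`, `t ∈ [τw, wfirstAt R]`: dissipation budget, source, the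
  smoothing half-smallness and the readout domination (contain `agmonConst`, non-numeric today) -/
  budget : ∀ t ∈ Icc τw (Host.wfirstAt R), X₁ (t - τw) + ∫ s in (t - τw)..t, ((4 * G s + 3 * κ * σ₂ s) * X₁ s +
      4 * agmonConst ^ 4 * X₁ s ^ 3 / (1 : ℝ) ^ 3 + 4 / 1 * Rr s ^ 2 + 3 * σ₂ s / κ * L s ^ 2) ≤ Dτ t
  Ψτ_def : ∀ t ∈ Icc τw (Host.wfirstAt R), ∫ s in (t - τw)..t, ψ₂ s ≤ Ψτ t
  half₃ : ∀ t ∈ Icc τw (Host.wfirstAt R), agmonConst ^ 2 * μ / 1 *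
      Real.exp (∫ s in (t - τw)..t, (6 * G s + 9 * κ * σ₂ s + 3 * κ ^ 2 * σ₃ s +
        3 * agmonConst ^ 2 * X₁ s / (1 * μ) + 27 * agmonConst ^ 4 * X₁ s ^ 2 / (16 * (1 : ℝ) ^ 3))) *
      (2 * Dτ t / (1 * τw) + Ψτ t) * τw ≤ 1 / 2
  readout_late : ∀ t ∈ Icc τw (Host.wfirstAt R), agmonConst * (3 * X₁ t *
    (2 * Real.exp (∫ s in (t - τw)..t, (6 * G s + 9 * κ * σ₂ s + 3 * κ ^ 2 * σ₃ s +
        3 * agmonConst ^ 2 * X₁ s / (1 * μ) + 27 * agmonConst ^ 4 * X₁ s ^ 2 / (16 * (1 : ℝ) ^ 3))) *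
      (2 * Dτ t / (1 * τw) + Ψτ t))) ^ (1 / 4 : ℝ) ≤ δ
  /-- the four explicit readouts with margins `η + δ`, `η > 0` -/
  η_pos : 0 < η
  cap : ∀ t ∈ Icc 0 (Host.wfirstAt R), ∀ x, ‖w t x‖ ≤ 5 / 3 * R.Y 1 - η - δ
  speed : ∃ x, ‖x‖ ≤ ρ ∧ R.Y 1 + η + δ ≤ ‖w (Host.wfirstAt R) x‖
  strainFD : ∃ x₀ x₁, ‖x₀‖ ≤ ρ ∧ ‖x₁‖ ≤ ρ ∧
    (R.A 1 + η) * ‖x₁ - x₀‖ + 2 * δ < ‖w (Host.wfirstAt R) x₁ - w (Host.wfirstAt R) x₀‖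
  core : ∃ (x : EuclideanSpace ℝ (Fin 3)) (γ : ℝ → EuclideanSpace ℝ (Fin 3)),
    ‖x‖ ≤ ρ ∧ ContDiff ℝ 1 γ ∧ γ 0 = γ 1 ∧
    (∀ s ∈ Icc (0 : ℝ) 1, γ s ∈ closedBall x (1 / R.N 1)) ∧
    (∀ s ∈ Icc (0 : ℝ) 1, ‖deriv γ s‖ ≤ 8 * Real.pi / R.N 1) ∧
    R.N 1 ^ (R.β - 2) + η + δ * (8 * Real.pi / R.N 1) ≤ circulation (w (Host.wfirstAt R)) γ

variable {R : TowerRates}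

/-- **THE HYBRID-CURRENCY STRAIN DOOR AT `R`, COMPOSED (route (A′))**: the mechanism door at `R` and one hybrid-currency
strain certificate at `R` give `EpisodeBaseGAt R` (`StrainShadowHybrid.exists_freeRun_near_of_strainHybrid`, then the
currency-free core `episodeBaseGAt_of_mechanismDoorAt_of_nearFreeRun`, p530553). [cite: RobinsonRodrigoSadowskiCUP2016, Thm 9.1 and Thm 1.20]
[cite: ConstantinFoias1988, Ch. 10] [cite: Tao2011, Thm. 5.4 (ii)+(iv)] [cite: Palasek2026ElementaryModel, §4] -/
theorem episodeBaseGAt_of_mechanismDoorAt_of_certificateDataHybrid (hdoor : MechanismDoorAt R)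
    {U : EuclideanSpace ℝ (Fin 3) → EuclideanSpace ℝ (Fin 3)} {ρ : ℝ}
    {w r : ℝ → EuclideanSpace ℝ (Fin 3) → EuclideanSpace ℝ (Fin 3)} {ϖ : ℝ → EuclideanSpace ℝ (Fin 3) → ℝ}
    {G σ₂ σ₃ Rr L H₁ ψ₁ ψ₂ X₁ Dτ Ψτ : ℝ → ℝ} {Bw E₀ κ μ D₁ Ψ₁ D₂ Ψ₂ δ η τw : ℝ}
    (c : CertificateDataHybrid R U ρ w r ϖ G σ₂ σ₃ Rr L H₁ ψ₁ ψ₂ X₁ Dτ Ψτ Bw E₀ κ μ D₁ Ψ₁ D₂ Ψ₂ δ η τw) :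
    EpisodeBaseGAt R := by
  have hUc : HasCompactSupport U :=
    IsCompact.of_isClosed_subset (isCompact_closedBall (0 : EuclideanSpace ℝ (Fin 3)) ρ)
      (isClosed_tsupport U) c.datum_support
  obtain ⟨v', q', hv', hv'0, hv'E, hnear'⟩ :=
    StrainShadowHybrid.exists_freeRun_near_of_strainHybrid (Host.wfirstAt_pos R) c.τw_pos c.τw_le c.run c.sobolev
      c.sobolev_t c.pressure c.residual_L2 c.residual_D c.speed_bdd c.κ_pos c.μ_pos c.strain c.G_nonneg c.hess c.third
      c.Rr_nonneg c.residual_two c.L_def c.H₁_def c.ψ₁_def c.ψ₂_def c.G_cont c.σ₂_cont c.σ₃_cont c.Rr_cont c.L_cont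
      c.X₁_cont c.H₁_cont c.ψ₁_cont c.ψ₂_cont c.datum_smooth hUc c.datum_divFree c.E₀_nonneg c.datum_two c.datum_H1
      c.datum_H2 c.Ψ₁_def c.Ψ₂_def c.half₁ c.X₁_dom c.half₂ c.readout_early c.budget c.Ψτ_def c.half₃ c.readout_late
  have hslice : Continuous (w (Host.wfirstAt R)) :=
    (c.run.contDiff_velocity ⟨(Host.wfirstAt_pos R).le, le_rfl⟩).continuous
  exact episodeBaseGAt_of_mechanismDoorAt_of_nearFreeRun hdoor c.datum_smooth c.datum_divFree c.datum_support
    c.datum_lt c.radius_nonneg hv' hv'0 hv'E hnear' c.η_pos hslice c.cap c.speed c.strainFD c.core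

/-- **AT `tuned` THE DOOR IS PAID**: one hybrid-currency strain certificate at `TowerRates.tuned` gives
`EpisodeBaseGAt TowerRates.tuned` (the mechanism door is the tree's `Germ.mechanismDoorAt_of_boxNumerics` at
`TowerRates.tuned_boxNumerics`, p537983). [cite: Palasek2026ElementaryModel, §4] -/
theorem episodeBaseGAt_tuned_of_certificateDataHybrid
    {U : EuclideanSpace ℝ (Fin 3) → EuclideanSpace ℝ (Fin 3)} {ρ : ℝ}
    {w r : ℝ → EuclideanSpace ℝ (Fin 3) → EuclideanSpace ℝ (Fin 3)} {ϖ : ℝ → EuclideanSpace ℝ (Fin 3) → ℝ}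
    {G σ₂ σ₃ Rr L H₁ ψ₁ ψ₂ X₁ Dτ Ψτ : ℝ → ℝ} {Bw E₀ κ μ D₁ Ψ₁ D₂ Ψ₂ δ η τw : ℝ}
    (c : CertificateDataHybrid TowerRates.tuned U ρ w r ϖ G σ₂ σ₃ Rr L H₁ ψ₁ ψ₂ X₁ Dτ Ψτ Bw E₀ κ μ D₁ Ψ₁ D₂ Ψ₂ δ η τw) :
    EpisodeBaseGAt TowerRates.tuned :=
  episodeBaseGAt_of_mechanismDoorAt_of_certificateDataHybrid
    (Germ.mechanismDoorAt_of_boxNumerics TowerRates.tuned_boxNumerics) c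

end Summit.NavierStokesRegularity.FluidComputer.PalasekTowerClayBridge.StrainDoor

end
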